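import Summits.QuantumFields.YangMills.Theorems.BalabanUVNodesN11CondExpFibreSections

/-!
# DAG node N11 — (hce₀) ⟺ (hsec): def-T's skew conditional expectation of `ρ` IS `R` a.e. IFF, for a.e. frozen retained configuration `y`, `R(y,·)` IS THE FIBRE TRANSPORT
# of `ρ(y,·)` — the per-old-branch debt of the (O3′) clause as ONE identity per frozen `y` between a def-T transport on the fibre and `R̃_{S₀}(y,·)`

HEADER — WORK-UNIT METADATA.  Cell `pub-ymgap`, YM-PLAN Track A (HUMAN RULING D-0062), seat `pub-ymgap-dag-n11-e` (g23; R134 fan-out seat N11 [B14], strategy s3), route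
`BalabanUVNodes`, item K1⁹ `StabilityBRunRowsAtRecordR13SepCoPHV` = stmt-QuantumFields-27364 (helper lane, `--kind proof --supports 27364 --as helper`, count-neutral).
[I] = [Balaban1987RG1], [III] = [Balaban1988Convergent].  FILE 4 (sequel of this seat's p653309 `…N11CondExpFibreSections`: ★★★ `ae_kernelTransport_skew_section_ae_eq_fibre` —
the frozen-`y` sections of the skew transport ARE the fibre transports; `map_skew_absolutelyContinuous_of_fibre`; record letters) over node00-def-T's `T4AveragingDisintegration`.

WHY THIS FILE.  After p652250 ∕ p653309 the displayed identity of dag-n11-d's (O3′) road has three equivalent forms (hce₀) ⟺ (hweak) ⟺ (hfib), all quantifying over test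
functions.  THIS FILE gives the TEST-FREE fourth form and proves it equivalent:
  (hsec)  for `μy`-a.e. `y`:  `R(y,·) =ᵐ[μ₂] kernelTransport ν μ₂ (φ(y,·)) (ρ(y,·))`
— «at a.e. frozen retained configuration, the candidate's section IS def-T's disintegration transport of the fibre density along the fibre map».  (hce₀) ⇒ (hsec): slices of
an a.e. equality + ★★★; (hsec) ⇒ (hce₀): the sections of the skew transport and of `R` agree for a.e. `y`, and a jointly (a.e.-strongly-)measurable pair agreeing slice-wise agrees
jointly (`Measure.ae_prod_mem_iff_ae_ae_mem` on measurable modifications).  At the record (§2, ANY finite `sV`, `sV'` under saturation; §3, 11a's generation letters, hypothesis-free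
but `k + 1 ≤ m + K`) this reads: the supplier's (hce₀) for `R̃_{S₀}` holds IFF for a.e. `y ∈ SU(N)^{B_k(Ω^c_{k+1})}` the function `R̃_{S₀}(y,·)` of the new variables is the def-T
transport `kernelTransport (⊗_{b∉sV} dU) (⊗_{c∉sV'} dV) (u ↦ (Ū(e(y,u))(c))_{c∉sV'}) (u ↦ piece_{S₀}(e(y,u)))` — ONE def-T `kernelTransport` per frozen `y`, on which the tree's
transport-level tools (gauge-fixing laws p618524 ∕ p620090 ∕ p622555 ∕ p624257, the chart sockets p610288 ∕ p651125, `IsRT` ∕ integrability rows) act directly.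

WHAT THIS FILE PROVES (0 `def`, 0 `sorry`, standard axioms).
§1 (generic; standard Borel carriers, finite measures; `R` only a.e.-strongly measurable): ★★★ `condExp_iff_ae_section` · ★★ `ae_section_of_condExp` · ★★ `condExp_of_ae_section`.
§2 (record letters, ANY finite `sV`, `sV'`, `Y` saturated, `sV ⊆ B_k(Y)`, `B_{k+1}(Y) ⊆ sV'`, ANY integrable `ρ`): ★★★ `condExp_iff_ae_section_at_record`.
§3 (dag-n11-d's letters `(ν M g p) hk (s′ : SeqOfRecord … p.K (k+1))`): ★★★ `condExp_iff_ae_section_Omega`.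

HONEST FRAMING.  Helper lane of K1⁹; count-neutral; [folklore] measure theory over def-T's DEFINITIONS; nothing of Bałaban's ([I] §2, [III] Thm 2 ∕ (3.10)–(3.25)) asserted — the
identity with the supplier's `R̃_{S₀}` stays DISPLAYED in dag-n11-d's theorems; (O3′) NOT closed; N11 NOT discharged; K1⁹ NOT closed, no registered stub touched; counts unmoved
(typed 28∕28 · discharged 5∕27 · A 5∕28).  One finite `𝕋⁴_{L^K}` programme at fixed `ε = L^{−K}`; R4 closes only the conditional finite-𝕋⁴ rung `BalabanLadder.UV` — NOT ℝ⁴,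
NOT OS, NOT a mass gap, NOT Clay.  No `sorry`, `axiom`, `def`, `instance`, `notation`.
Sources (SHAPE ∕ bookkeeping only): [III] (2.21) p.258, (3.1) p.264, (3.10)–(3.11) p.266, (3.12)–(3.14) p.267, (3.23)–(3.25) p.270; [I] (0.4) p.253, §2 p.267.
-/

noncomputable section

open MeasureTheory ProbabilityTheory
open scoped ENNReal NNReal BigOperators

namespace Summit.QuantumFields.YangMills.Theorems.BalabanUVNodesN11CondExpIffFibreTransport

open Literature.MathematicalPhysics.QuantumFieldTheory.Balaban1983to89
open Literature.MathematicalPhysics.QuantumFieldTheory.Balaban1983to89.T4AveragingDisintegration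
open BalabanUVNodesN11CondExpFibreSections (map_skew_absolutelyContinuous_of_fibre ae_kernelTransport_skew_section_ae_eq_fibre
  map_pi_avOfRecord_glue_fibre_absolutelyContinuous)
open BalabanUVNodesN11AveragingSkewPresentationAtRecord (toFine_mem_compl_Omega_iff)

/-! ## §1  Generic -/

section Generic

variable {Y U V : Type*} [MeasurableSpace Y] [MeasurableSpace U] [MeasurableSpace V]
variable [StandardBorelSpace Y] [StandardBorelSpace U] [StandardBorelSpace V] [Nonempty Y] [Nonempty U]

/-- ★★ **(hce) ⟹ (hsec)**: if the skew conditional expectation of `ρ` is `R` a.e., then for `μy`-a.e. `y` the section `R(y,·)` IS the fibre transport of `ρ(y,·)` along `φ(y,·)`,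
`μ₂`-a.e. (slices of the a.e. equality + the sections theorem ★★★ of `…N11CondExpFibreSections`). [cite: Balaban1988Convergent, (3.1) p.264, (3.10)–(3.14) pp.266–267 (SHAPE); Balaban1987RG1, (0.4) p.253] -/
theorem ae_section_of_condExp (μy : Measure Y) [IsFiniteMeasure μy] (ν : Measure U) [IsFiniteMeasure ν] (μ₂ : Measure V) [IsFiniteMeasure μ₂]
    {ρ : Y × U → ℝ} (hρ : Integrable ρ (μy.prod ν)) {φ : Y × U → V} (hφ : Measurable φ) (hac : ∀ y, ν.map (fun u => φ (y, u)) ≪ μ₂)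
    {R : Y × V → ℝ} (hce : kernelTransport (μy.prod ν) (μy.prod μ₂) (fun q : Y × U => (q.1, φ q)) ρ =ᵐ[μy.prod μ₂] R) :
    ∀ᵐ y ∂μy, (fun v => R (y, v)) =ᵐ[μ₂] kernelTransport ν μ₂ (fun u => φ (y, u)) (fun u => ρ (y, u)) := by
  filter_upwards [Measure.ae_ae_eq_curry_of_prod hce, ae_kernelTransport_skew_section_ae_eq_fibre μy ν μ₂ hρ hφ hac] with y hy hs
  have hy' : (fun v => kernelTransport (μy.prod ν) (μy.prod μ₂) (fun q : Y × U => (q.1, φ q)) ρ (y, v)) =ᵐ[μ₂] fun v => R (y, v) := hy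
  exact hy'.symm.trans hs

/-- ★★ **(hsec) ⟹ (hce)**: if for `μy`-a.e. `y` the section `R(y,·)` is the fibre transport of `ρ(y,·)` a.e., and `R` is a.e.-strongly measurable on the product, then the skew
conditional expectation of `ρ` IS `R` a.e. (the two agree slice-wise for a.e. `y` by ★★★; measurable modifications agreeing slice-wise agree jointly,
`Measure.ae_prod_mem_iff_ae_ae_mem`). [cite: Balaban1988Convergent, (3.1) p.264, (3.10)–(3.14) pp.266–267 (SHAPE); Balaban1987RG1, (0.4) p.253] -/
theorem condExp_of_ae_section (μy : Measure Y) [IsFiniteMeasure μy] (ν : Measure U) [IsFiniteMeasure ν] (μ₂ : Measure V) [IsFiniteMeasure μ₂]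
    {ρ : Y × U → ℝ} (hρ : Integrable ρ (μy.prod ν)) {φ : Y × U → V} (hφ : Measurable φ) (hac : ∀ y, ν.map (fun u => φ (y, u)) ≪ μ₂)
    {R : Y × V → ℝ} (hR : AEStronglyMeasurable R (μy.prod μ₂))
    (hs : ∀ᵐ y ∂μy, (fun v => R (y, v)) =ᵐ[μ₂] kernelTransport ν μ₂ (fun u => φ (y, u)) (fun u => ρ (y, u))) :
    kernelTransport (μy.prod ν) (μy.prod μ₂) (fun q : Y × U => (q.1, φ q)) ρ =ᵐ[μy.prod μ₂] R := by
  have hsk : Measurable (fun q : Y × U => (q.1, φ q)) := measurable_fst.prodMk hφ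
  have hacj := map_skew_absolutelyContinuous_of_fibre μy ν μ₂ hφ (ae_of_all _ hac)
  set T := kernelTransport (μy.prod ν) (μy.prod μ₂) (fun q : Y × U => (q.1, φ q)) ρ with hT_def
  have hT : Integrable T (μy.prod μ₂) := integrable_kernelTransport _ _ hsk hacj hρ
  -- slice-wise agreement for a.e. `y`
  have h1 : ∀ᵐ y ∂μy, (fun v => R (y, v)) =ᵐ[μ₂] fun v => T (y, v) := by
    filter_upwards [hs, ae_kernelTransport_skew_section_ae_eq_fibre μy ν μ₂ hρ hφ hac] with y hy hsy
    exact hy.trans hsy.symm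
  -- measurable modifications agree on a measurable set of full slices, hence jointly
  have hRR' : R =ᵐ[μy.prod μ₂] hR.mk R := hR.ae_eq_mk
  have hTT' : T =ᵐ[μy.prod μ₂] hT.1.mk T := hT.1.ae_eq_mk
  have hS : MeasurableSet {z : Y × V | hR.mk R z = hT.1.mk T z} :=
    measurableSet_eq_fun hR.stronglyMeasurable_mk.measurable hT.1.stronglyMeasurable_mk.measurable
  have h2 : ∀ᵐ z ∂(μy.prod μ₂), z ∈ {z : Y × V | hR.mk R z = hT.1.mk T z} := by
    rw [Measure.ae_prod_mem_iff_ae_ae_mem hS]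
    filter_upwards [h1, Measure.ae_ae_eq_curry_of_prod hRR', Measure.ae_ae_eq_curry_of_prod hTT'] with y hy hRy hTy
    have hRy' : (fun v => R (y, v)) =ᵐ[μ₂] fun v => hR.mk R (y, v) := hRy
    have hTy' : (fun v => T (y, v)) =ᵐ[μ₂] fun v => hT.1.mk T (y, v) := hTy
    filter_upwards [hy, hRy', hTy'] with v hv hRv hTv
    show hR.mk R (y, v) = hT.1.mk T (y, v)
    rw [← hRv, ← hTv]
    exact hv
  have h2' : hT.1.mk T =ᵐ[μy.prod μ₂] hR.mk R := h2.mono fun z hz => Eq.symm hz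
  exact hTT'.trans (h2'.trans hRR'.symm)

/-- ★★★ **(hce) ⟺ (hsec)** — the TEST-FREE form of the displayed identity: def-T's skew conditional expectation of `ρ` is `R` a.e. IFF for a.e. frozen `y` the section `R(y,·)`
is def-T's fibre transport `kernelTransport ν μ₂ (φ(y,·)) (ρ(y,·))`, a.e. [cite: Balaban1988Convergent, (3.1) p.264, (3.10)–(3.14) pp.266–267, (3.23)–(3.25) p.270 (SHAPE); Balaban1987RG1, (0.4) p.253, §2 p.267] -/
theorem condExp_iff_ae_section (μy : Measure Y) [IsFiniteMeasure μy] (ν : Measure U) [IsFiniteMeasure ν] (μ₂ : Measure V) [IsFiniteMeasure μ₂]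
    {ρ : Y × U → ℝ} (hρ : Integrable ρ (μy.prod ν)) {φ : Y × U → V} (hφ : Measurable φ) (hac : ∀ y, ν.map (fun u => φ (y, u)) ≪ μ₂)
    {R : Y × V → ℝ} (hR : AEStronglyMeasurable R (μy.prod μ₂)) :
    kernelTransport (μy.prod ν) (μy.prod μ₂) (fun q : Y × U => (q.1, φ q)) ρ =ᵐ[μy.prod μ₂] R ↔
    ∀ᵐ y ∂μy, (fun v => R (y, v)) =ᵐ[μ₂] kernelTransport ν μ₂ (fun u => φ (y, u)) (fun u => ρ (y, u)) :=
  ⟨ae_section_of_condExp μy ν μ₂ hρ hφ hac, condExp_of_ae_section μy ν μ₂ hρ hφ hac hR⟩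

end Generic

/-! ## §2  Record letters -/

section Record

open Node00 hiding SU
open Node00.Tk T4Continuum BlockAveraging
open B10Eq42TorusConstraint (bondsIn)
open B10Eq38TorusDomains (toFine)

variable (F : T4Family) (N : ℕ) [NeZero N]

/-- ★★★ **AT THE RECORD: (hce) ⟺ (hsec)** — for ANY `dU`-integrable fine density `ρ`, `Y` saturated, `sV ⊆ B_k(Y)`, `B_{k+1}(Y) ⊆ sV'`, and any candidate `R` a.e.-strongly
measurable on `(⊗_{sV} dU) ⊗ (⊗_{sV'ᶜ} dV)`: `kernelTransport μ_in μ_out skew (ρ ∘ e) =ᵐ R` IFF for a.e. retained `y`,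
`R(y,·) =ᵐ kernelTransport (⊗_{b∉sV} dU) (⊗_{c∉sV'} dV) (u ↦ (Ū(e(y,u))(c))_{c∉sV'}) (u ↦ ρ(e(y,u)))`.
[cite: Balaban1988Convergent, (2.21) p.258, (3.1) p.264, (3.10)–(3.14) pp.266–267, (3.23)–(3.25) p.270; Balaban1987RG1, (0.4) p.253, §2 p.267] -/
theorem condExp_iff_ae_section_at_record (K k : ℕ) {hdec : DecidableEq (PBond (F.P K) k)} {hdec' : DecidableEq (PBond (F.P K) (k + 1))}
    (hk : k + 1 ≤ (F.P K).m + (F.P K).K)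
    {Y : Set (Site (F.P K) 0)} (hY : ∀ x : Site (F.P K) k, toFine k x ∈ Y ↔ toFine (k + 1) (blockOf x) ∈ Y)
    {sV : Finset (PBond (F.P K) k)} (hsV : ∀ b : PBond (F.P K) k, b ∈ sV → b ∈ bondsIn k Y)
    {sV' : Finset (PBond (F.P K) (k + 1))} (hsV' : ∀ c : PBond (F.P K) (k + 1), c ∈ bondsIn (k + 1) Y → c ∈ sV')
    {ρ : GaugeField (F.P K) k (SU N) → ℝ} (hρ : Integrable ρ (fieldMeasure (F.P K) k (SU N)))
    {R : (↥sV → SU N) × ({c : PBond (F.P K) (k + 1) // c ∉ sV'} → SU N) → ℝ}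
    (hR : AEStronglyMeasurable R ((Measure.pi fun _ : ↥sV => (HaarData.haar : Measure (SU N))).prod
      (Measure.pi fun _ : {c : PBond (F.P K) (k + 1) // c ∉ sV'} => (HaarData.haar : Measure (SU N))))) :
    kernelTransport
        ((Measure.pi fun _ : ↥sV => (HaarData.haar : Measure (SU N))).prod
          (Measure.pi fun _ : {b : PBond (F.P K) k // b ∉ sV} => (HaarData.haar : Measure (SU N))))
        ((Measure.pi fun _ : ↥sV => (HaarData.haar : Measure (SU N))).prod
          (Measure.pi fun _ : {c : PBond (F.P K) (k + 1) // c ∉ sV'} => (HaarData.haar : Measure (SU N))))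
        (fun q => (q.1, fun c : {c : PBond (F.P K) (k + 1) // c ∉ sV'} =>
          (avOfRecord F N K k).avg ((MeasurableEquiv.piEquivPiSubtypeProd (fun _ : PBond (F.P K) k => SU N) (· ∈ sV)).symm q) c))
        (ρ ∘ ⇑(MeasurableEquiv.piEquivPiSubtypeProd (fun _ : PBond (F.P K) k => SU N) (· ∈ sV)).symm)
      =ᵐ[(Measure.pi fun _ : ↥sV => (HaarData.haar : Measure (SU N))).prod
          (Measure.pi fun _ : {c : PBond (F.P K) (k + 1) // c ∉ sV'} => (HaarData.haar : Measure (SU N)))] R ↔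
    ∀ᵐ y ∂(Measure.pi fun _ : ↥sV => (HaarData.haar : Measure (SU N))),
      (fun v => R (y, v)) =ᵐ[Measure.pi fun _ : {c : PBond (F.P K) (k + 1) // c ∉ sV'} => (HaarData.haar : Measure (SU N))]
      kernelTransport (Measure.pi fun _ : {b : PBond (F.P K) k // b ∉ sV} => (HaarData.haar : Measure (SU N)))
        (Measure.pi fun _ : {c : PBond (F.P K) (k + 1) // c ∉ sV'} => (HaarData.haar : Measure (SU N)))
        (fun u => fun c : {c : PBond (F.P K) (k + 1) // c ∉ sV'} =>
          (avOfRecord F N K k).avg ((MeasurableEquiv.piEquivPiSubtypeProd (fun _ : PBond (F.P K) k => SU N) (· ∈ sV)).symm (y, u)) c)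
        (fun u => ρ ((MeasurableEquiv.piEquivPiSubtypeProd (fun _ : PBond (F.P K) k => SU N) (· ∈ sV)).symm (y, u))) := by
  have hpres := measurePreserving_piEquivPiSubtypeProd_symm_fieldMeasure (G := SU N) (P := F.P K) (j := k) sV
  have hρ' := (hpres.integrable_comp hρ.aestronglyMeasurable).mpr hρ
  exact condExp_iff_ae_section _ _ _ hρ' (measurable_avOfRecord_glue_rest F N K k sV sV')
    (map_pi_avOfRecord_glue_fibre_absolutelyContinuous F N K k hk hY hsV hsV') hR

end Record

/-! ## §3  At dag-n11-d's letters `sV = B_k(Ω^c_{k+1}(s′))`, `sV' = B_{k+1}(Ω^c_{k+1}(s′))` -/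

section Omega

open Node00 hiding SU
open Node00.Tk T4Continuum BlockAveraging
open B10Eq42TorusConstraint (bondsIn)
open B10Eq38TorusDomains (toFine)

variable {F : T4Family} {N : ℕ} [NeZero N]

/-- ★★★ **(hce₀) ⟺ (hsec) at 11a's generation letters** — hypothesis-free but `k + 1 ≤ m + K`: for ANY `dU`-integrable `ρ` and any a.e.-strongly measurable candidate `R` on
`μ_out`, def-T's skew conditional expectation of `ρ ∘ e` IS `R` a.e. IFF for a.e. retained `y ∈ SU(N)^{B_k(Ω^c_{k+1}(s′))}` the section `R(y,·)` IS the def-T fibre transport of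
`u ↦ ρ(e(y,u))` along `u ↦ (Ū(e(y,u))(c))_{c ∉ sV'}`.  With `R := R̃_{S₀}` and `ρ :=` the old graph piece this is the (O3′) debt per old branch as ONE def-T identity per frozen `y`.
[cite: Balaban1988Convergent, (2.18) p.257, (2.21) p.258, (3.1) p.264, (3.10)–(3.14) pp.266–267, (3.23)–(3.25) p.270; Balaban1987RG1, (0.4) p.253, §2 p.267] -/
theorem condExp_iff_ae_section_Omega (ν : Stage7Numerics) (M : ℕ) (g : ℕ → ℝ) (p : B12.RunParams)
    {k : ℕ} {hdec : DecidableEq (PBond (F.P p.K) k)} {hdec' : DecidableEq (PBond (F.P p.K) (k + 1))} (hk : k + 1 ≤ (F.P p.K).m + (F.P p.K).K)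
    (s' : SeqOfRecord F ν M g p.K (k + 1)) {ρ : GaugeField (F.P p.K) k (SU N) → ℝ} (hρ : Integrable ρ (fieldMeasure (F.P p.K) k (SU N)))
    {R : ((↥(Set.toFinite (bondsIn k (s'.Ω (k + 1))ᶜ)).toFinset → SU N) × ({c : PBond (F.P p.K) (k + 1) // c ∉ (Set.toFinite (bondsIn (k + 1) (s'.Ω (k + 1))ᶜ)).toFinset} → SU N)) → ℝ}
    (hR : AEStronglyMeasurable R ((Measure.pi fun _ : ↥(Set.toFinite (bondsIn k (s'.Ω (k + 1))ᶜ)).toFinset => (HaarData.haar : Measure (SU N))).prod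
      (Measure.pi fun _ : {c : PBond (F.P p.K) (k + 1) // c ∉ (Set.toFinite (bondsIn (k + 1) (s'.Ω (k + 1))ᶜ)).toFinset} => (HaarData.haar : Measure (SU N))))) :
    kernelTransport
        ((Measure.pi fun _ : ↥(Set.toFinite (bondsIn k (s'.Ω (k + 1))ᶜ)).toFinset => (HaarData.haar : Measure (SU N))).prod
          (Measure.pi fun _ : {b : PBond (F.P p.K) k // b ∉ (Set.toFinite (bondsIn k (s'.Ω (k + 1))ᶜ)).toFinset} => (HaarData.haar : Measure (SU N))))
        ((Measure.pi fun _ : ↥(Set.toFinite (bondsIn k (s'.Ω (k + 1))ᶜ)).toFinset => (HaarData.haar : Measure (SU N))).prod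
          (Measure.pi fun _ : {c : PBond (F.P p.K) (k + 1) // c ∉ (Set.toFinite (bondsIn (k + 1) (s'.Ω (k + 1))ᶜ)).toFinset} =>
            (HaarData.haar : Measure (SU N))))
        (fun q => (q.1, fun c : {c : PBond (F.P p.K) (k + 1) // c ∉ (Set.toFinite (bondsIn (k + 1) (s'.Ω (k + 1))ᶜ)).toFinset} =>
          (avOfRecord F N p.K k).avg
            ((MeasurableEquiv.piEquivPiSubtypeProd (fun _ : PBond (F.P p.K) k => SU N)
              (· ∈ (Set.toFinite (bondsIn k (s'.Ω (k + 1))ᶜ)).toFinset)).symm q) c))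
        (ρ ∘ ⇑(MeasurableEquiv.piEquivPiSubtypeProd (fun _ : PBond (F.P p.K) k => SU N)
            (· ∈ (Set.toFinite (bondsIn k (s'.Ω (k + 1))ᶜ)).toFinset)).symm)
      =ᵐ[((Measure.pi fun _ : ↥(Set.toFinite (bondsIn k (s'.Ω (k + 1))ᶜ)).toFinset => (HaarData.haar : Measure (SU N))).prod
          (Measure.pi fun _ : {c : PBond (F.P p.K) (k + 1) // c ∉ (Set.toFinite (bondsIn (k + 1) (s'.Ω (k + 1))ᶜ)).toFinset} =>
            (HaarData.haar : Measure (SU N))))] R ↔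
    ∀ᵐ y ∂(Measure.pi fun _ : ↥(Set.toFinite (bondsIn k (s'.Ω (k + 1))ᶜ)).toFinset => (HaarData.haar : Measure (SU N))),
      (fun v => R (y, v)) =ᵐ[Measure.pi fun _ : {c : PBond (F.P p.K) (k + 1) // c ∉ (Set.toFinite (bondsIn (k + 1) (s'.Ω (k + 1))ᶜ)).toFinset} =>
          (HaarData.haar : Measure (SU N))]
      kernelTransport
        (Measure.pi fun _ : {b : PBond (F.P p.K) k // b ∉ (Set.toFinite (bondsIn k (s'.Ω (k + 1))ᶜ)).toFinset} => (HaarData.haar : Measure (SU N)))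
        (Measure.pi fun _ : {c : PBond (F.P p.K) (k + 1) // c ∉ (Set.toFinite (bondsIn (k + 1) (s'.Ω (k + 1))ᶜ)).toFinset} => (HaarData.haar : Measure (SU N)))
        (fun u => fun c : {c : PBond (F.P p.K) (k + 1) // c ∉ (Set.toFinite (bondsIn (k + 1) (s'.Ω (k + 1))ᶜ)).toFinset} =>
          (avOfRecord F N p.K k).avg
            ((MeasurableEquiv.piEquivPiSubtypeProd (fun _ : PBond (F.P p.K) k => SU N)
              (· ∈ (Set.toFinite (bondsIn k (s'.Ω (k + 1))ᶜ)).toFinset)).symm (y, u)) c)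
        (fun u => ρ ((MeasurableEquiv.piEquivPiSubtypeProd (fun _ : PBond (F.P p.K) k => SU N)
            (· ∈ (Set.toFinite (bondsIn k (s'.Ω (k + 1))ᶜ)).toFinset)).symm (y, u))) :=
  condExp_iff_ae_section_at_record F N p.K k (hdec := hdec) (hdec' := hdec') hk (toFine_mem_compl_Omega_iff s' hk)
    (fun b hb => (mem_toFinite_bondsIn_toFinset_iff _ b).1 hb) (fun c hc => (mem_toFinite_bondsIn_toFinset_iff _ c).2 hc) hρ hR

end Omega

end Summit.QuantumFields.YangMills.Theorems.BalabanUVNodesN11CondExpIffFibreTransport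

end
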